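import Mathlib
import HarnessLib
import Summits.NavierStokesRegularity.NavierStokesRegularity.Theorems.PoloidalWindowDoorLrcModEntireCurvedSheetJet
import Summits.NavierStokesRegularity.NavierStokesRegularity.Theorems.PoloidalWindowDoorLrcModEntireQ4SonicSheetSpeedClass
import Summits.NavierStokesRegularity.NavierStokesRegularity.Theorems.PoloidalWindowDoorLrcModEntireQ4SonicHotSheetJet
import Summits.NavierStokesRegularity.NavierStokesRegularity.Theorems.PoloidalWindowDoorLrcModEntireRidgeWebDynamics
import Summits.NavierStokesRegularity.NavierStokesRegularity.Theorems.PoloidalWindowDoorPoloidalWindowRigidityTimeHeightShearLinearSlice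
import Summits.NavierStokesRegularity.NavierStokesRegularity.Theorems.PoloidalWindowDoorPoloidalWindowRigidityConstantShearSlice
import Summits.NavierStokesRegularity.NavierStokesRegularity.Theorems.LocalSineTubeDoorProfileAlignedWindowRigidityAncient

/-!
# Route `PoloidalWindowDoor`, item `LrcModEntire` (stmt-NavierStokesRegularity-20428), cell (Q4-curved) of the (TH) column —
# B-SPEEDc: THE WEB-SPEED LAW AT A POINT OF A CURVED PARALLEL WEB SHEET (the `∂_ν`-differentiated vertical equation in the Fermi frame)

Cell ns-regularity-ideate, helper seat ns-k2-port-2 g9 under the LEAD of item 20428 (ns-poloidal-K2-p3 g17, memo `Cruxes/LrcModEntire/T2B-g17.md` §6(6b)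
«THE CROSS-WEB VELOCITY IS KNOWN UP TO α(s): … `U_ν = V + (1−μ)(a₃/a₂ − k_J) + (s-free)`», §6(6e) brick «B-SPEEDc (Fermi speed law, M)», §6(6d)(ii) Duty-C
«the Fermi-frame speed law with `∂_νΔₕθ = a₃ − k_J a₂`»); `--supports stmt-NavierStokesRegularity-20428 --as helper`.  The curved analogue of port-2 g8's
`…Q4SonicSheetSpeedLaw.sonic_sheet_speed_law` (straight SONIC sheet); here the sheet is CURVED and ARBITRARY (no characteristic hypothesis).

SETTING.  Class profile `U` with the (TH) slab law `∂_zU_b = μ(t,z)∂_bU₂` (`b = 0,1`) for `|t+1| < ρ`, `|x₂| < ρ`, slope `μ ∈ C³` jointly; a time `t = −1+τ`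
(`|τ| < 1/2`, `|τ| < ρ`); a `C²` unit-speed planar branch `Γ` with Frenet law `Γ″ = k•JΓ′`; an open height window `I ⊂ (−ρ,ρ)` with a `C^∞` offset `d` on `I` and
Fermi factor `J = 1 − k(s)d(z) ≠ 0`; the CURVED PARALLEL WEB SHEET `W(s,z) = Γ(s) + d(z)·JΓ′(s) + z·e₂` of horizontally critical points of `θ := U₂(t,·)`
(`∂_{Γ′}θ(W) = ∂_{JΓ′}θ(W) = 0` on `ℝ × I`).  Notation at `x = W(s,z)`: `T = Γ′(s)`, `ν = JΓ′(s)`, `a₂ = D²θ(x)[ν,ν]`, `a₃ = D³θ(x)[ν,ν,ν]`, `μ = μ(t,z)`,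
`μ_z = ∂_zμ(t,z)`, `d′ = d′(z)`.

* `laplacian_normalDeriv_of_sliceLaw` (class-free) — at a point of the slab where the coordinate slice law `∂₂²θ = −μ(x₂)Δₕθ` holds nearby, for a horizontal unit
  `T` and `ν = JT`: **`D(Δθ)(x)[ν] = (1 − μ(x₂))·(D³θ(x)[ν,T,T] + D³θ(x)[ν,ν,ν])`** (`Δθ = (1−μ)Δₕθ` differentiated along the horizontal `ν`; frame invariance
  of the horizontal trace).
* `normalDeriv_timeDeriv_algebra` (pure algebra) — the assembly step.
* ★ `curved_sheet_normalDeriv_timeDeriv` (class level) — **`J·D(∂ₜU₂(t,·))(x)[ν] = (1−μ)·(J·a₃ − k·a₂) − J·a₂·(⟪U(t,x), ν⟫ − d′·U₂(t,x)) + 2μ_z·d′·J·a₂/(1−μ)`**,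
  from port-2 g8's source identity `…Q4SonicSheetSpeedClass.normalDeriv_timeDeriv_of_horizCritical` (`D(∂ₜθ)[ν] = D(Δθ)[ν] − D²θ[ν,U] − 2μ_zD²θ[ν,e₂]/(1−μ)` at a
  horizontally critical point), `laplacian_normalDeriv_of_sliceLaw`, and items (i) `D²θ[T,ν] = 0`, (iii) `J·D³θ[ν,T,T] = −k·a₂`, (iv) `D²θ[e₂,ν] = −d′a₂` of
  `…CurvedSheetJet.curved_sheet_jet` (this seat), with the frame decomposition `U = ⟪U,T⟫T + ⟪U,ν⟫ν + U₂e₂`.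
* ★★ `curved_sheet_speed_law` (class level) — with the kinematic sheet-speed hypothesis of normal speed `V` at `(τ, x)` (the space–time Hessian of `σU₂` kills
  `((1, V•ν), (0, ν))`, supplied by the space–time web function; `…RidgeWebDynamics.sheetSpeed_eq_fderiv_timeDeriv` turns it into `V·a₂ = −D(∂ₜθ)[ν]`):
  **`J·V·a₂ = −(1−μ)·(J·a₃ − k·a₂) + J·a₂·(⟪U(t,x), ν⟫ − d′·U₂(t,x)) − 2μ_z·d′·J·a₂/(1−μ)`**, i.e. for `a₂ ≠ 0`, `J ≠ 0`:
  `⟪U,ν⟫ = V + (1−μ)·(a₃/a₂ − k_J) + d′·U₂ + 2μ_z d′/(1−μ)` — the memo's (6b) with the «s-free» tail `d′·(U₂(t,x) + 2μ_z/(1−μ))` explicit (`U₂(t,W(s,z)) = σR(τ,z)`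
  by (Q3∞)).  At `k ≡ 0` and `d′² + μ = 0` this is g8's `sonic_sheet_speed_law` (`1 − μ = 1 + d′²`).
WHAT THIS IS NOT: not a claim about Navier–Stokes regularity — an identity of the (TH) column on a curved web sheet (bears on the research slots
`stub_Q4curvedAperiodic` / `stub_Q4sonicLineNegIsolated`, registry twist_split v13/v14, T2B-g17 §6); no stub is closed here; items 20428 / 19708 / 27893 OPEN.
-/

noncomputable section

set_option linter.dupNamespace false
set_option linter.style.longLine false

namespace Summit.NavierStokesRegularity.NavierStokesRegularity.Theorems.PoloidalWindowDoorLrcModEntireCurvedSheetSpeedLaw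

open Set Function Filter Topology Metric
open scoped RealInnerProductSpace InnerProductSpace Laplacian ContDiff
open Literature.Analysis Literature.Analysis.FluidPDE Literature.Analysis.UnboundedOperators
open Summit.NavierStokesRegularity.NavierStokesRegularity.Theorems
open Summit.NavierStokesRegularity.NavierStokesRegularity.Theorems.LocalSineTubeDoorProfileAlignedWindowRigidityAncient
open Summit.NavierStokesRegularity.NavierStokesRegularity.Theorems.PoloidalWindowDoorPoloidalWindowRigidityWindow
open Summit.NavierStokesRegularity.NavierStokesRegularity.Theorems.PoloidalWindowDoorPoloidalWindowRigidityTimeHeightShearLinearSlice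
open Summit.NavierStokesRegularity.NavierStokesRegularity.Theorems.PoloidalWindowDoorPoloidalWindowRigidityConstantShearSlice
open Summit.NavierStokesRegularity.NavierStokesRegularity.Theorems.PoloidalWindowDoorLrcModEntireSheetFlattenTools
open Summit.NavierStokesRegularity.NavierStokesRegularity.Theorems.PoloidalWindowDoorLrcModEntireParallelWebsIdentity
open Summit.NavierStokesRegularity.NavierStokesRegularity.Theorems.PoloidalWindowDoorLrcModEntireRidgeGlobalBranchODE
open Summit.NavierStokesRegularity.NavierStokesRegularity.Theorems.PoloidalWindowDoorLrcModEntireRidgeGlobalBranchFrame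
open Summit.NavierStokesRegularity.NavierStokesRegularity.Theorems.PoloidalWindowDoorLrcModEntirePlanarCurveRigidity
open Summit.NavierStokesRegularity.NavierStokesRegularity.Theorems.PoloidalWindowDoorLrcModEntireCurvedWebHuygens
open Summit.NavierStokesRegularity.NavierStokesRegularity.Theorems.PoloidalWindowDoorLrcModEntireCurvedSheetTransport
open Summit.NavierStokesRegularity.NavierStokesRegularity.Theorems.PoloidalWindowDoorLrcModEntireCurvedSheetJet
open Summit.NavierStokesRegularity.NavierStokesRegularity.Theorems.PoloidalWindowDoorLrcModEntireThreadPins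
open Summit.NavierStokesRegularity.NavierStokesRegularity.Theorems.PoloidalWindowDoorLrcModEntireThreadPressure
open Summit.NavierStokesRegularity.NavierStokesRegularity.Theorems.PoloidalWindowDoorLrcModEntireRidgeClassConstants
open Summit.NavierStokesRegularity.NavierStokesRegularity.Theorems.PoloidalWindowDoorLrcModEntireRidgeWebDynamics
open Summit.NavierStokesRegularity.NavierStokesRegularity.Theorems.PoloidalWindowDoorLrcModEntireQ4SonicHotSheetSecondPins
open Summit.NavierStokesRegularity.NavierStokesRegularity.Theorems.PoloidalWindowDoorLrcModEntireQ4SonicSheetSpeedClass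
open Summit.NavierStokesRegularity.NavierStokesRegularity.Theorems.PoloidalWindowDoorLrcModEntireQ4SonicHotSheetJet

/-! ### A. Class-free: the normal derivative of the Laplacian under the slice law -/

/-- **`D(Δθ)(x)[ν] = (1 − μ(x₂))·(D³θ(x)[ν,T,T] + D³θ(x)[ν,ν,ν])`** at a point of the open slab `{x₂ ∈ I}` carrying the coordinate slice law
`∂₂²θ = −μ(x₂)(∂₀²θ + ∂₁²θ)`, for a horizontal unit `T` and `ν = JT` (class-free). -/
theorem laplacian_normalDeriv_of_sliceLaw {θ : EuclideanSpace ℝ (Fin 3) → ℝ} (hθ : ContDiff ℝ ∞ θ)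
    {I : Set ℝ} (hI : IsOpen I) {μ : ℝ → ℝ}
    (hlaw : ∀ x : EuclideanSpace ℝ (Fin 3), x 2 ∈ I →
      fderiv ℝ (fun y => fderiv ℝ θ y (EuclideanSpace.single 2 (1 : ℝ))) x (EuclideanSpace.single 2 (1 : ℝ)) =
        -μ (x 2) * (fderiv ℝ (fun y => fderiv ℝ θ y (EuclideanSpace.single 0 (1 : ℝ))) x (EuclideanSpace.single 0 (1 : ℝ)) +
          fderiv ℝ (fun y => fderiv ℝ θ y (EuclideanSpace.single 1 (1 : ℝ))) x (EuclideanSpace.single 1 (1 : ℝ))))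
    {x : EuclideanSpace ℝ (Fin 3)} (hx : x 2 ∈ I) (hμ : DifferentiableAt ℝ μ (x 2))
    {T : EuclideanSpace ℝ (Fin 3)} (hT2 : T 2 = 0) (hTu : ‖T‖ = 1) :
    fderiv ℝ (Δ θ) x (rotJ T) =
      (1 - μ (x 2)) * (fderiv ℝ (fderiv ℝ (fderiv ℝ θ)) x (rotJ T) T T + fderiv ℝ (fderiv ℝ (fderiv ℝ θ)) x (rotJ T) (rotJ T) (rotJ T)) := by
  have hθ3 : ContDiff ℝ 3 θ := hθ.of_le (by norm_cast)
  have hθ2 : ContDiff ℝ 2 θ := hθ.of_le (by norm_cast)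
  have hD2c : ContDiff ℝ 1 (fderiv ℝ (fderiv ℝ θ)) := (hθ3.fderiv_right (m := 2) (by norm_cast)).fderiv_right (m := 1) (by norm_cast)
  have hD2 := hD2c.differentiable one_ne_zero
  set ν : EuclideanSpace ℝ (Fin 3) := rotJ T with hνdef
  set D := fderiv ℝ (fderiv ℝ (fderiv ℝ θ)) x with hD
  have hν2 : ν 2 = 0 := (rotJ_facts hT2 hTu).1
  -- (1) `∂_ν` of the slice law at `x`: `D[ν,e₂,e₂] + μ (D[ν,e₀,e₀] + D[ν,e₁,e₁]) = 0`
  have hL : D ν e2 e2 + μ (x 2) * (D ν e0 e0 + D ν e1 e1) = 0 := by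
    set S : EuclideanSpace ℝ (Fin 3) → ℝ := fun y => fderiv ℝ (fderiv ℝ θ) y e2 e2 +
      μ (y 2) * (fderiv ℝ (fderiv ℝ θ) y e0 e0 + fderiv ℝ (fderiv ℝ θ) y e1 e1) with hS
    have hSO : IsOpen {y : EuclideanSpace ℝ (Fin 3) | y 2 ∈ I} := hI.preimage (EuclideanSpace.proj (𝕜 := ℝ) (2 : Fin 3)).continuous
    have hS0 : ∀ y ∈ {y : EuclideanSpace ℝ (Fin 3) | y 2 ∈ I}, S y = 0 := by
      intro y hy
      have h := hlaw y hy
      rw [nested_eq_fderiv_fderiv hθ2, nested_eq_fderiv_fderiv hθ2, nested_eq_fderiv_fderiv hθ2] at h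
      simp only [hS, e0, e1, e2]
      linear_combination h
    have hxmem : x ∈ {y : EuclideanSpace ℝ (Fin 3) | y 2 ∈ I} := hx
    have hev : S =ᶠ[𝓝 x] fun _ => 0 := Filter.eventuallyEq_of_mem (hSO.mem_nhds hxmem) fun y hy => hS0 y hy
    have hSfd : fderiv ℝ S x ν = 0 := by rw [hev.fderiv_eq]; simp
    have hμy : HasFDerivAt (fun y : EuclideanSpace ℝ (Fin 3) => μ (y 2))
        ((ContinuousLinearMap.smulRight (1 : ℝ →L[ℝ] ℝ) (deriv μ (x 2))).comp (EuclideanSpace.proj (𝕜 := ℝ) (2 : Fin 3))) x :=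
      hμ.hasDerivAt.hasFDerivAt.comp x (EuclideanSpace.proj (𝕜 := ℝ) (2 : Fin 3)).hasFDerivAt
    have hBc : ∀ a b : EuclideanSpace ℝ (Fin 3), HasFDerivAt (fun y => fderiv ℝ (fderiv ℝ θ) y a b)
        (fderiv ℝ (fun y => fderiv ℝ (fderiv ℝ θ) y a b) x) x := fun a b =>
      (((hD2 x).clm_apply (differentiableAt_const a)).clm_apply (differentiableAt_const b)).hasFDerivAt
    have hS' := (hBc e2 e2).add (hμy.mul ((hBc e0 e0).add (hBc e1 e1)))
    have hS'' : HasFDerivAt S _ x := hS'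
    rw [hS''.fderiv] at hSfd
    simp only [_root_.add_apply, _root_.smul_apply, smul_eq_mul, ContinuousLinearMap.comp_apply,
      ContinuousLinearMap.smulRight_apply, ContinuousLinearMap.one_def, ContinuousLinearMap.id_apply,
      fderiv_hessian_apply_const hθ3, Pi.add_apply] at hSfd
    have hν2' : (EuclideanSpace.proj (𝕜 := ℝ) (2 : Fin 3)) ν = 0 := hν2
    rw [hν2'] at hSfd
    simp only [mul_zero, zero_mul, add_zero] at hSfd
    simp only [hD]
    linear_combination hSfd
  -- (2) `D(Δθ)[ν] = Σᵢ D[eᵢ,eᵢ,ν] = Σᵢ D[ν,eᵢ,eᵢ]`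
  have hsum := fderiv_laplacian_apply_eq_sum_thirdDeriv (hθ3.contDiffAt (x := x)) ν
  rw [Fin.sum_univ_three] at hsum
  have hsw : ∀ a : EuclideanSpace ℝ (Fin 3), fderiv ℝ (fderiv ℝ (fderiv ℝ θ)) x a a ν = D ν a a := fun a => by
    rw [hD, fderiv3_swap23 hθ3 x a a ν, fderiv3_swap12 hθ3 x a ν a]
  rw [show EuclideanSpace.single (0 : Fin 3) (1 : ℝ) = e0 from rfl, show EuclideanSpace.single (1 : Fin 3) (1 : ℝ) = e1 from rfl,
    show EuclideanSpace.single (2 : Fin 3) (1 : ℝ) = e2 from rfl, hsw e0, hsw e1, hsw e2] at hsum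
  -- (3) frame invariance of the horizontal trace for the bilinear form `D ν`
  have hft := frame_trace (D ν) hT2 hTu
  rw [hsum]
  simp only [hD, hνdef] at hL hft ⊢
  linear_combination hL - (1 - μ (x 2)) * hft

/-! ### B. Pure algebra: the assembly step -/

/-- The assembly of the speed law from the source identity, the Laplacian identity, the frame decomposition of `U` and the web-point jet
(pure algebra; `J ≠ 0` is not needed in this direction). -/
theorem normalDeriv_timeDeriv_algebra {θtν DΔ BνU Bνe2 BTν a₂ a₃ DνTT UT Uν U2 μ μz d' k J : ℝ}
    (hsrc : θtν = DΔ - BνU - 2 * μz * Bνe2 / (1 - μ))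
    (hΔ : DΔ = (1 - μ) * (DνTT + a₃))
    (hU : BνU = UT * BTν + Uν * a₂ + U2 * Bνe2)
    (hi : BTν = 0) (hiii : J * DνTT + k * a₂ = 0) (hiv : d' * a₂ + Bνe2 = 0) :
    J * θtν = (1 - μ) * (J * a₃ - k * a₂) - J * a₂ * (Uν - d' * U2) + 2 * μz * d' * J * a₂ / (1 - μ) := by
  have hB : Bνe2 = -(d' * a₂) := by linear_combination hiv
  rw [hsrc, hΔ, hU, hi, hB]
  have : J * DνTT = -(k * a₂) := by linear_combination hiii
  rw [show (1 - μ) * (DνTT + a₃) = (1 - μ) * DνTT + (1 - μ) * a₃ by ring]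
  field_simp
  linear_combination (1 - μ) * hiii


/-! ### C. Class level: the speed law on a curved web sheet -/

section classlevel

variable {C : ℝ} {U : ℝ → EuclideanSpace ℝ (Fin 3) → EuclideanSpace ℝ (Fin 3)} {μ : ℝ → ℝ → ℝ} {ρ τ : ℝ} {I : Set ℝ}
  {d k : ℝ → ℝ} {Γ : ℝ → EuclideanSpace ℝ (Fin 3)}

/-- The height of a point of the curved parallel web sheet: `(Γ(s) + n·JΓ′(s) + z·e₂)₂ = z` for a planar branch. -/
theorem curvedSheetPoint_two (hpl : ∀ s, Γ s 2 = 0) (s n z : ℝ) : (Γ s + n • rotJ (deriv Γ s) + z • e2) 2 = z := by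
  have h := (rotJ_apply (deriv Γ s)).2.2
  simp [hpl s, h, e2]

/-- ★ **THE NORMAL DERIVATIVE OF `∂ₜU₂` AT A POINT OF A CURVED PARALLEL WEB SHEET (every term explicit).**  See the module docstring.  With `t = −1+τ`,
`θ = U₂(t,·)`, `x = Γ(s) + d(z)·JΓ′(s) + z·e₂`, `ν = JΓ′(s)`, `J = 1 − k(s)d(z)`, `a₂ = D²θ(x)[ν,ν]`, `a₃ = D³θ(x)[ν,ν,ν]`:
`J·D(∂ₜU₂(t,·))(x)[ν] = (1−μ)·(J·a₃ − k·a₂) − J·a₂·(⟪U(t,x), ν⟫ − d′·U₂(t,x)) + 2μ_z·d′·J·a₂/(1−μ)`. -/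
theorem curved_sheet_normalDeriv_timeDeriv
    (hrate : HasTypeITimeDecay C U) (hcont : ContinuousOn (uncurry U) (Iio (0 : ℝ) ×ˢ univ))
    (hmild : ∀ s t : ℝ, s < t → t < 0 → ∀ x, U t x = heatExtension (U s) (t - s) x - oseenDuhamel 1 s U U t x)
    (hdiv : ∀ t < 0, VectorCalculus.IsDivFree (U t))
    (hpol : ∀ s < 0, ∀ y, ⟪curl (U s) y, EuclideanSpace.single 2 1⟫_ℝ = 0)
    (hμ3 : ContDiff ℝ 3 (uncurry μ))
    (hslabU : ∀ t : ℝ, |t + 1| < ρ → ∀ x : EuclideanSpace ℝ (Fin 3), |x 2| < ρ → ∀ b : Fin 3, b ≠ 2 →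
      fderiv ℝ (U t) x (EuclideanSpace.single 2 1) b = μ t (x 2) * fderiv ℝ (U t) x (EuclideanSpace.single b 1) 2)
    (hτ : |τ| < 1 / 2) (hτρ : |τ| < ρ)
    (hΓ : ContDiff ℝ 2 Γ) (hpl : ∀ s, Γ s 2 = 0) (hun : ∀ s, ‖deriv Γ s‖ = 1)
    (hk : ∀ s, deriv (deriv Γ) s = k s • rotJ (deriv Γ s))
    (hI : IsOpen I) (hIρ : ∀ z ∈ I, |z| < ρ) (hd : ContDiffOn ℝ ∞ d I)
    (hJ : ∀ s : ℝ, ∀ z ∈ I, 1 - k s * d z ≠ 0)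
    (hν : ∀ s : ℝ, ∀ z ∈ I, fderiv ℝ (fun y => U (-1 + τ) y 2) (Γ s + d z • rotJ (deriv Γ s) + z • e2) (rotJ (deriv Γ s)) = 0)
    (hT : ∀ s : ℝ, ∀ z ∈ I, fderiv ℝ (fun y => U (-1 + τ) y 2) (Γ s + d z • rotJ (deriv Γ s) + z • e2) (deriv Γ s) = 0)
    (s : ℝ) {z : ℝ} (hz : z ∈ I) (hμ1 : μ (-1 + τ) z ≠ 1) :
    (1 - k s * d z) * fderiv ℝ (fun x => deriv (fun s' => U s' x 2) (-1 + τ)) (Γ s + d z • rotJ (deriv Γ s) + z • e2) (rotJ (deriv Γ s)) =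
      (1 - μ (-1 + τ) z) *
          ((1 - k s * d z) * fderiv ℝ (fderiv ℝ (fderiv ℝ (fun y => U (-1 + τ) y 2))) (Γ s + d z • rotJ (deriv Γ s) + z • e2)
              (rotJ (deriv Γ s)) (rotJ (deriv Γ s)) (rotJ (deriv Γ s)) -
            k s * fderiv ℝ (fderiv ℝ (fun y => U (-1 + τ) y 2)) (Γ s + d z • rotJ (deriv Γ s) + z • e2) (rotJ (deriv Γ s)) (rotJ (deriv Γ s)))
        - (1 - k s * d z) * fderiv ℝ (fderiv ℝ (fun y => U (-1 + τ) y 2)) (Γ s + d z • rotJ (deriv Γ s) + z • e2) (rotJ (deriv Γ s)) (rotJ (deriv Γ s)) *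
            (⟪U (-1 + τ) (Γ s + d z • rotJ (deriv Γ s) + z • e2), rotJ (deriv Γ s)⟫ - deriv d z * U (-1 + τ) (Γ s + d z • rotJ (deriv Γ s) + z • e2) 2)
        + 2 * deriv (μ (-1 + τ)) z * deriv d z * (1 - k s * d z) *
            fderiv ℝ (fderiv ℝ (fun y => U (-1 + τ) y 2)) (Γ s + d z • rotJ (deriv Γ s) + z • e2) (rotJ (deriv Γ s)) (rotJ (deriv Γ s)) / (1 - μ (-1 + τ) z) := by
  set t : ℝ := -1 + τ with ht_def
  have ht : t < 0 := by rw [ht_def]; linarith [(abs_lt.1 hτ).2]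
  have htρ : |t + 1| < ρ := by rw [ht_def]; simpa using hτρ
  set θ : EuclideanSpace ℝ (Fin 3) → ℝ := fun y => U t y 2 with hθ_def
  set W : EuclideanSpace ℝ (Fin 3) := Γ s + d z • rotJ (deriv Γ s) + z • e2 with hW_def
  set T : EuclideanSpace ℝ (Fin 3) := deriv Γ s with hTdef
  set ν : EuclideanSpace ℝ (Fin 3) := rotJ (deriv Γ s) with hνdef
  have hW2 : W 2 = z := curvedSheetPoint_two hpl s (d z) z
  have hT2 : T 2 = 0 := (deriv_horizontal hΓ hpl s).1
  have hTu : ‖T‖ = 1 := hun s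
  have hν2 : ν 2 = 0 := (rotJ_facts hT2 hTu).1
  /- regularity of the slice -/
  have hUan : AnalyticOnNhd ℝ (U t) univ := analyticOnNhd_slice hcont (bdd_of_hasTypeITimeDecay hrate) hmild ht
  have hU2 : ContDiff ℝ 2 (U t) := hUan.contDiff.of_le le_top
  have hθan : AnalyticOnNhd ℝ θ univ := fun x _ =>
    ((EuclideanSpace.proj (𝕜 := ℝ) (2 : Fin 3)).analyticAt _).comp (hUan x (mem_univ _))
  have hθ : ContDiff ℝ ∞ θ := hθan.contDiff
  have hθ2 : ContDiff ℝ 2 θ := hθ.of_le (by norm_cast)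
  have hsymm : ∀ u w, fderiv ℝ (fderiv ℝ θ) W u w = fderiv ℝ (fderiv ℝ θ) W w u := fun u w =>
    (hθ2.contDiffAt.isSymmSndFDerivAt (by simp)) u w
  /- the slope on the window and the coordinate slice law on the slab `{x₂ ∈ I}` -/
  have hμfun : μ t = uncurry μ ∘ fun z : ℝ => (t, z) := by funext z; rfl
  have hμd : ∀ z ∈ I, DifferentiableAt ℝ (μ t) z := fun z _ => by
    rw [hμfun]; exact ((hμ3.differentiable (by norm_num)) _).comp z ((differentiableAt_const _).prodMk differentiableAt_id)
  have hplane : ∀ z : ℝ, |z| < ρ → ∀ y : EuclideanSpace ℝ (Fin 3), y 2 = z → ∀ b : Fin 3, b ≠ 2 →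
      fderiv ℝ (U t) y (EuclideanSpace.single 2 (1 : ℝ)) b = μ t z * fderiv ℝ (U t) y (EuclideanSpace.single b (1 : ℝ)) 2 := by
    intro z hz y hy b hb
    have h := hslabU t htρ y (by rw [hy]; exact hz) b hb
    rw [hy] at h; exact h
  have hlawI : ∀ x : EuclideanSpace ℝ (Fin 3), x 2 ∈ I →
      fderiv ℝ (fun y => fderiv ℝ θ y (EuclideanSpace.single 2 (1 : ℝ))) x (EuclideanSpace.single 2 (1 : ℝ)) =
        -μ t (x 2) * (fderiv ℝ (fun y => fderiv ℝ θ y (EuclideanSpace.single 0 (1 : ℝ))) x (EuclideanSpace.single 0 (1 : ℝ)) +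
          fderiv ℝ (fun y => fderiv ℝ θ y (EuclideanSpace.single 1 (1 : ℝ))) x (EuclideanSpace.single 1 (1 : ℝ))) := fun x hx =>
    plane_wave_identity hU2 (fun y => div_coord (hdiv t ht) y) (hplane (x 2) (hIρ _ hx)) rfl
  /- the web-point jet (this seat's `curved_sheet_jet`) and the Laplacian identity -/
  obtain ⟨hi, -, hiii, hiv, -, -, -⟩ := curved_sheet_jet hθ hI hμd hd hΓ hpl hun hk hJ hlawI hν hT s hz
  have hΔ := laplacian_normalDeriv_of_sliceLaw hθ hI hlawI (x := W) (by rw [hW2]; exact hz) (by rw [hW2]; exact hμd z hz) hT2 hTu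
  rw [hW2] at hΔ
  /- the source identity at the horizontally critical point `W` -/
  have hslope : ∀ y : EuclideanSpace ℝ (Fin 3), y 2 = W 2 →
      ∀ᶠ q in 𝓝 ((t, y) : ℝ × EuclideanSpace ℝ (Fin 3)), ∀ b : Fin 3, b ≠ 2 →
        fderiv ℝ (U q.1) q.2 (EuclideanSpace.single 2 1) b = μ q.1 (q.2 2) * fderiv ℝ (U q.1) q.2 (EuclideanSpace.single b 1) 2 := by
    intro y hy
    have hO : IsOpen {q : ℝ × EuclideanSpace ℝ (Fin 3) | |q.1 + 1| < ρ ∧ |q.2 2| < ρ} := by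
      refine IsOpen.and ?_ ?_
      · exact isOpen_lt (continuous_abs.comp (continuous_fst.add continuous_const)) continuous_const
      · exact isOpen_lt (continuous_abs.comp ((EuclideanSpace.proj (𝕜 := ℝ) (2 : Fin 3)).continuous.comp continuous_snd)) continuous_const
    have hmem : ((t, y) : ℝ × EuclideanSpace ℝ (Fin 3)) ∈ {q : ℝ × EuclideanSpace ℝ (Fin 3) | |q.1 + 1| < ρ ∧ |q.2 2| < ρ} := by
      refine ⟨htρ, ?_⟩
      show |y 2| < ρ
      rw [hy, hW2]; exact hIρ z hz
    filter_upwards [hO.mem_nhds hmem] with q hq b hb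
    exact hslabU q.1 hq.1 q.2 hq.2 b hb
  have hμ1' : μ t (W 2) ≠ 1 := by rw [hW2]; exact hμ1
  have hgradh : ∀ w : EuclideanSpace ℝ (Fin 3), w 2 = 0 → fderiv ℝ θ W w = 0 := by
    intro w hw
    rw [horiz_expand hw hT2 hTu, map_add, map_smul, map_smul]
    have h1 : fderiv ℝ θ W T = 0 := hT s z hz
    have h2 : fderiv ℝ θ W ν = 0 := hν s z hz
    simp only [hTdef, hνdef] at h1 h2 ⊢
    rw [h1, h2]; simp
  have hsrc := normalDeriv_timeDeriv_of_horizCritical hrate hcont hmild hdiv hpol hμ3 ht hslope hμ1' hgradh (deriv Γ s)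
  rw [Jvec_eq_rotJ, hW2] at hsrc
  /- the frame decomposition of `U(t,W)` in `D²θ(W)[ν, U]` -/
  have hab : T 0 ^ 2 + T 1 ^ 2 = 1 := sq_add_sq_of_horizontal_unit hT2 hTu
  have hUdec := frame_decomp hT2 hab (U t W)
  have hBU : fderiv ℝ (fderiv ℝ θ) W ν (U t W) =
      (U t W 0 * T 0 + U t W 1 * T 1) * fderiv ℝ (fderiv ℝ θ) W ν T + ⟪U t W, ν⟫ * fderiv ℝ (fderiv ℝ θ) W ν ν +
        U t W 2 * fderiv ℝ (fderiv ℝ θ) W ν e2 := by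
    have hin : ⟪U t W, ν⟫ = U t W 1 * T 0 - U t W 0 * T 1 := by
      rw [hνdef, (inner_horizontal hT2).2]; ring
    conv_lhs => rw [hUdec]
    rw [Jvec_eq_rotJ, map_add, map_add, map_smul, map_smul, map_smul, hin]
    simp only [smul_eq_mul, hTdef, hνdef]
  /- assemble -/
  have hi' : fderiv ℝ (fderiv ℝ θ) W ν T = 0 := by rw [hsymm]; simpa [hW_def, hTdef, hνdef] using hi
  have hiv' : deriv d z * fderiv ℝ (fderiv ℝ θ) W ν ν + fderiv ℝ (fderiv ℝ θ) W ν e2 = 0 := by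
    rw [hsymm ν e2]; simpa [hW_def, hνdef] using hiv
  have hiii' : (1 - k s * d z) * fderiv ℝ (fderiv ℝ (fderiv ℝ θ)) W ν T T + k s * fderiv ℝ (fderiv ℝ θ) W ν ν = 0 := by
    simpa [hW_def, hTdef, hνdef] using hiii
  have key := normalDeriv_timeDeriv_algebra (UT := U t W 0 * T 0 + U t W 1 * T 1) (Uν := ⟪U t W, ν⟫) (U2 := U t W 2)
    hsrc hΔ hBU hi' hiii' hiv'
  simpa [hW_def, hνdef, hTdef, hθ_def, ht_def, show EuclideanSpace.single (2 : Fin 3) (1 : ℝ) = e2 from rfl] using key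

/-- ★★ **THE WEB-SPEED LAW AT A POINT OF A CURVED PARALLEL WEB SHEET.**  With the kinematic sheet-speed hypothesis `hkin` of normal speed `V` at `(τ, x)`:
`J·V·a₂ = −(1−μ)·(J·a₃ − k·a₂) + J·a₂·(⟪U(t,x), ν⟫ − d′·U₂(t,x)) − 2μ_z·d′·J·a₂/(1−μ)` — i.e. for `a₂ ≠ 0`, `J ≠ 0`:
`⟪U,ν⟫ = V + (1−μ)(a₃/a₂ − k_J) + d′·(U₂ + 2μ_z/(1−μ))` (T2B-g17 §6(6b)). -/
theorem curved_sheet_speed_law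
    (hrate : HasTypeITimeDecay C U) (hcont : ContinuousOn (uncurry U) (Iio (0 : ℝ) ×ˢ univ))
    (hmild : ∀ s t : ℝ, s < t → t < 0 → ∀ x, U t x = heatExtension (U s) (t - s) x - oseenDuhamel 1 s U U t x)
    (hdiv : ∀ t < 0, VectorCalculus.IsDivFree (U t))
    (hpol : ∀ s < 0, ∀ y, ⟪curl (U s) y, EuclideanSpace.single 2 1⟫_ℝ = 0)
    (hμ3 : ContDiff ℝ 3 (uncurry μ))
    (hslabU : ∀ t : ℝ, |t + 1| < ρ → ∀ x : EuclideanSpace ℝ (Fin 3), |x 2| < ρ → ∀ b : Fin 3, b ≠ 2 →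
      fderiv ℝ (U t) x (EuclideanSpace.single 2 1) b = μ t (x 2) * fderiv ℝ (U t) x (EuclideanSpace.single b 1) 2)
    (hτ : |τ| < 1 / 2) (hτρ : |τ| < ρ)
    (hΓ : ContDiff ℝ 2 Γ) (hpl : ∀ s, Γ s 2 = 0) (hun : ∀ s, ‖deriv Γ s‖ = 1)
    (hk : ∀ s, deriv (deriv Γ) s = k s • rotJ (deriv Γ s))
    (hI : IsOpen I) (hIρ : ∀ z ∈ I, |z| < ρ) (hd : ContDiffOn ℝ ∞ d I)
    (hJ : ∀ s : ℝ, ∀ z ∈ I, 1 - k s * d z ≠ 0)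
    (hν : ∀ s : ℝ, ∀ z ∈ I, fderiv ℝ (fun y => U (-1 + τ) y 2) (Γ s + d z • rotJ (deriv Γ s) + z • e2) (rotJ (deriv Γ s)) = 0)
    (hT : ∀ s : ℝ, ∀ z ∈ I, fderiv ℝ (fun y => U (-1 + τ) y 2) (Γ s + d z • rotJ (deriv Γ s) + z • e2) (deriv Γ s) = 0)
    (s : ℝ) {z : ℝ} (hz : z ∈ I) (hμ1 : μ (-1 + τ) z ≠ 1)
    {σ : ℝ} (hσ : σ = 1 ∨ σ = -1) {V : ℝ}
    (hkin : fderiv ℝ (fderiv ℝ (uncurry fun a y => σ * U (-1 + a) y 2)) (τ, Γ s + d z • rotJ (deriv Γ s) + z • e2)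
      ((1 : ℝ), V • rotJ (deriv Γ s)) ((0 : ℝ), rotJ (deriv Γ s)) = 0) :
    (1 - k s * d z) * V * fderiv ℝ (fderiv ℝ (fun y => U (-1 + τ) y 2)) (Γ s + d z • rotJ (deriv Γ s) + z • e2) (rotJ (deriv Γ s)) (rotJ (deriv Γ s)) =
      -((1 - μ (-1 + τ) z) *
          ((1 - k s * d z) * fderiv ℝ (fderiv ℝ (fderiv ℝ (fun y => U (-1 + τ) y 2))) (Γ s + d z • rotJ (deriv Γ s) + z • e2)
              (rotJ (deriv Γ s)) (rotJ (deriv Γ s)) (rotJ (deriv Γ s)) -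
            k s * fderiv ℝ (fderiv ℝ (fun y => U (-1 + τ) y 2)) (Γ s + d z • rotJ (deriv Γ s) + z • e2) (rotJ (deriv Γ s)) (rotJ (deriv Γ s))))
        + (1 - k s * d z) * fderiv ℝ (fderiv ℝ (fun y => U (-1 + τ) y 2)) (Γ s + d z • rotJ (deriv Γ s) + z • e2) (rotJ (deriv Γ s)) (rotJ (deriv Γ s)) *
            (⟪U (-1 + τ) (Γ s + d z • rotJ (deriv Γ s) + z • e2), rotJ (deriv Γ s)⟫ - deriv d z * U (-1 + τ) (Γ s + d z • rotJ (deriv Γ s) + z • e2) 2)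
        - 2 * deriv (μ (-1 + τ)) z * deriv d z * (1 - k s * d z) *
            fderiv ℝ (fderiv ℝ (fun y => U (-1 + τ) y 2)) (Γ s + d z • rotJ (deriv Γ s) + z • e2) (rotJ (deriv Γ s)) (rotJ (deriv Γ s)) / (1 - μ (-1 + τ) z) := by
  have hmain := curved_sheet_normalDeriv_timeDeriv hrate hcont hmild hdiv hpol hμ3 hslabU hτ hτρ hΓ hpl hun hk hI hIρ hd hJ hν hT s hz hμ1
  set t : ℝ := -1 + τ with ht_def
  have ht : t < 0 := by rw [ht_def]; linarith [(abs_lt.1 hτ).2]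
  have h1 : t ∈ Iio (0 : ℝ) := ht
  set W : EuclideanSpace ℝ (Fin 3) := Γ s + d z • rotJ (deriv Γ s) + z • e2 with hW_def
  set ν : EuclideanSpace ℝ (Fin 3) := rotJ (deriv Γ s) with hνdef
  have hg6 := sheetSpeed_eq_fderiv_timeDeriv hrate hcont hmild hdiv hσ hτ (y₀ := W) (ν := ν) (V := V) hkin
  have hA : IsTypeIAncientMild C U := isTypeIAncientMild_of_class hrate hcont hmild hdiv
  have hsm : IsSmoothSpaceTimeOn (Iio 0) U := hA.contDiffOn
  have hslice : ContDiff ℝ ∞ (U t) := hsm.contDiff_slice h1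
  have hθ2 : ContDiff ℝ 2 (fun y => U t y 2) := PoloidalWindowDoorPoloidalWindowRigidityConstantShearMeans.contDiff_coord (hslice.of_le (by norm_cast)) 2
  have hconv1 : fderiv ℝ (fderiv ℝ (fun y => σ * U t y 2)) W ν ν = σ * fderiv ℝ (fderiv ℝ (fun y => U t y 2)) W ν ν :=
    fderiv_fderiv_const_mul_apply hθ2 σ W ν ν
  have hconv2 : (fun y : EuclideanSpace ℝ (Fin 3) => (timeDerivWithin (Iio 0) U t y) 2) = fun y => deriv (fun s' => U s' y 2) t := by
    funext y
    rw [timeDerivWithin_eq_deriv isOpen_Iio h1 U y, deriv_apply_coord (hsm.hasDerivAt_timeLine isOpen_Iio h1 y).differentiableAt 2]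
  rw [hconv1, hconv2] at hg6
  have hσσ : σ * σ = 1 := by rcases hσ with h | h <;> simp [h]
  -- `hg6 : V·σ·a₂ = −σ·θtν`; multiply by `σ` and by `J`, then substitute `hmain`
  set a₂ := fderiv ℝ (fderiv ℝ (fun y => U t y 2)) W ν ν with ha₂
  set θtν := fderiv ℝ (fun x => deriv (fun s' => U s' x 2) t) W ν with hθtν
  have hVa : V * a₂ = -θtν := by
    have h : σ * (V * (σ * a₂)) = σ * (-(σ * θtν)) := by rw [hg6]
    have h2 : σ * (V * (σ * a₂)) = (σ * σ) * (V * a₂) := by ring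
    have h3 : σ * (-(σ * θtν)) = -((σ * σ) * θtν) := by ring
    rw [h2, h3, hσσ] at h
    linarith
  linear_combination (1 - k s * d z) * hVa - hmain

end classlevel

end Summit.NavierStokesRegularity.NavierStokesRegularity.Theorems.PoloidalWindowDoorLrcModEntireCurvedSheetSpeedLaw

end
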